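import Literature.MathematicalPhysics.QuantumFieldTheory.Balaban1983to89.B9Eq3130TransferPairLetters

/-!
# `Balaban1983to89.B9Eq3130TransferPairDifference` — T. Bałaban, *Propagators for lattice gauge theories in a background field*, Commun. Math. Phys. **99** (1985)
# 389–434 [Balaban1985BackgroundPropagators] (3.130)–(3.131) pp. 421–422 (*«G = G₀(I − Δ′_πG₀)⁻¹ = Σ_{n=0}^{∞} G₀(Δ′_πG₀)ⁿ»*, *«This inequality and Theorem 3.3 for G₀
# imply a convergence of the series (3.130), for α₀ sufficiently small»*), (3.117) p. 419, (3.152) p. 426: **THE DIFFERENCE `G̃ − G₀` OF THE PAIR TRANSFER IS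
# ONE-SIDEDLY SMALL — (L)(G̃ − G₀; q₁·M′, κ′) ∧ (L)(D*∘G̃ − D*∘G₀; q₂·M′, κ′)** in the abstract frame of (K72) `B9Eq3130TransferPairLetters` (same carriers, same
# identities `hT`∕`h2`∕`h3`, same eight coefficient letters, same closed forms `q₁`, `q₂`, every summand of which carries the stencil constant `ε₁` or `ε₂`)

statement-level skeleton of published theorems with citation tags; proofs where landed; nothing here is a claim about the Yang–Mills mass gap

CITATION HEADER (lean-in-tree rule).  Audit cell `pub-balaban`, sub-cell `t4`, BINDER row NE9; filed by NE9 crux-team LEAF PROVER 05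
(`b2b-balaban-t4-ne9-formalise-leaf-05`, gen 88; (K78), the first brick of the OWNER t4-ne9-p1 g97's RULING R-ne9p1-g97-4 (2)(b), journal `HOME/CLAIMS.log` l.66556:
the point decay of `(Q_kG̃_kQ_k†)⁻¹` by a Neumann series around `(Q_kG1kQ_k†)⁻¹` needs `E = Q_k(G̃_k − G1k)Q_k†` SMALL, i.e. a one-sided letter of the DIFFERENCE).
Composed BY NAME from (K61) `B9Eq326G1SupRowOfLetters.letter_comp`; the proof is (K72) `transfer_pair_step`'s with the leading `G₀f` ∕ `D*G₀f` terms removed (the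
five `M`∕`M†`-carrying terms ARE the difference).  Source READ first-hand this generation (`paper:balaban1985-cmp99-background-propagators`, journal page = PDF page +
388): pp. 419–422, 426.  [folklore] letter algebra; NOTHING of print's (3.130)–(3.133) ∕ Thm 3.3 ∕ 3.13 is asserted, valued or discharged.

WHAT IS PROVED (sorry-free; proof lane — no `def`).  **`transfer_pair_diff`** — under the hypotheses of (K72) `transfer_pair_step` minus `κ′ < κ` (identities `hT`, `h2`,
`h3`; coefficient letters (L)(G₀; B₀, κ), (L)(D*∘G₀; B₁, κ), (L)(G′; B_G, κ), (L)(R; B_R, κ), (L)(D∘G′∘R; B_D, κ), (L)(M; ε₁, κ), (L)(M†; ε₂, κ); row constant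
`K` for the gap `κ − κ′`; a-priori letters (L)(G̃; M′, κ′), (L)(D*∘G̃; M′, κ′), `0 ≤ κ′`; the strict `κ′ < κ` of the step served only its leading terms): for the continuous linear maps `G̃ − G₀` and `D*∘G̃ − D*∘G₀`,
`‖((G̃ − G₀)f)(x)‖ ≤ (q₁·M′)·e^{−κ′δ(π_B x, v)}·F` and `‖((D*∘G̃ − D*∘G₀)f)(x)‖ ≤ (q₂·M′)·e^{−κ′δ(π_S x, v)}·F` for block-supported `f` with `‖f‖_∞ ≤ F`, with
(K72)'s closed forms `q₁ = B_RB_Gε₁B₀K⁴ + ε₂B_GB_DK³ + B_Dε₂B_GB_DK⁴ + ε₂B_GB_RB_Gε₁B₀K⁶ + B_Dε₂B_GB_RB_Gε₁B₀K⁷`, `q₂` = the same with `B₁`, `B_R` in place of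
`B₀`, `B_D` where (K72) has them.  At the tower (the instantiator's job, (K79)): `M′ :=` the CLOSED constant of the landed rows of `G̃_k` ((K77) ∕ the OWNER's
(T4B)), `ε₁, ε₂ ∝ j₀` ((K75)) ⟹ the difference is `O(j₀)` = print's `O(α₀)`.
HONEST SCOPE.  [folklore] composition; the identities and all letters are HYPOTHESES here; constants crude; nothing of [B9] asserted; «NE9 ⇐ the named binders»; NE9
NOT PRINTED ∕ NOT PROVED; row WALLED ON A MODEL (O-NE9-1; #5 UNRULED); spine PROVED 0∕9; rung (B)+1 on a finite T⁴ — NOT infinite volume, NOT mass gap, NOT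
BetaPertH, NOT Clay.  HONEST DEPENDENCY: continuum YM on T⁴ ⇐ BetaPertH ∧ nine spine estimates (0/9 proved); BetaPertH ⇐ (D1) ∧ (D4) ∧ CAP+tail; G-an2-4 gates asym,
D1 and NE2/3/4.  NEW file importing (K72) only (built); nothing modified.  Net new unproved facts: 0.
-/

noncomputable section

set_option autoImplicit false

open scoped BigOperators

namespace Literature.MathematicalPhysics.QuantumFieldTheory.Balaban1983to89.B9Eq3130TransferPairDifference

open B9Eq311L2Pairing (WL2)
open B9Eq326G1SupRowOfLetters (letter_comp)

section Abstract

variable {𝕜 : Type*} [RCLike 𝕜] {Y : Type*} [Fintype Y] (δ : Y → Y → ℝ)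
  {XB : Type*} [Fintype XB] [Nonempty XB] {wB : XB → ℝ} [Fact (∀ x, 0 < wB x)]
  {VB : Type*} [NormedAddCommGroup VB] [InnerProductSpace 𝕜 VB]
  {XS : Type*} [Fintype XS] {wS : XS → ℝ} [Fact (∀ x, 0 < wS x)]
  {VS : Type*} [NormedAddCommGroup VS] [InnerProductSpace 𝕜 VS]
  (πB : XB → Y) (πS : XS → Y)
  (G₀ Gt : WL2 𝕜 wB VB →L[𝕜] WL2 𝕜 wB VB) (D M : WL2 𝕜 wS VS →L[𝕜] WL2 𝕜 wB VB)
  (Ds Mt : WL2 𝕜 wB VB →L[𝕜] WL2 𝕜 wS VS) (Gp R : WL2 𝕜 wS VS →L[𝕜] WL2 𝕜 wS VS)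

/-! ## §1 The difference `G̃ − G₀` of the pair, one-sidedly small -/

/-- The triangle inequality for the five terms of `G̃ − G₀` in the expanded resolvent identity. [folklore] -/
private theorem norm_five_le {V : Type*} [NormedAddCommGroup V] (a b c d e : V) :
    ‖a + (b - c) - (d - e)‖ ≤ ‖a‖ + ‖b‖ + ‖c‖ + ‖d‖ + ‖e‖ := by
  calc ‖a + (b - c) - (d - e)‖ ≤ ‖a + (b - c)‖ + ‖d - e‖ := norm_sub_le _ _
    _ ≤ (‖a‖ + ‖b - c‖) + (‖d‖ + ‖e‖) := add_le_add (norm_add_le _ _) (norm_sub_le _ _)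
    _ ≤ (‖a‖ + (‖b‖ + ‖c‖)) + (‖d‖ + ‖e‖) := add_le_add (add_le_add le_rfl (norm_sub_le _ _)) le_rfl
    _ = _ := by ring

set_option maxHeartbeats 400000 in
/-- **THE DIFFERENCE `G̃ − G₀` OF THE PAIR IS ONE-SIDEDLY SMALL** — the hypotheses of `transfer_pair_step` without `κ′ < κ` (the identities `hT`, `h2`, `h3`, the eight
coefficient letters at rate `κ`, a-priori letters (L)(G̃; M′, κ′), (L)(D*∘G̃; M′, κ′) — for the CLOSED `M′` of `transfer_pair` these are its conclusions):
**(L)(G̃ − G₀; q₁·M′, κ′) ∧ (L)(D*∘G̃ − D*∘G₀; q₂·M′, κ′)** with the SAME closed forms `q₁`, `q₂` — every summand carries the stencil constant `ε₁` or `ε₂`,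
so the difference inherits the smallness of `M = Δ∘D_U` (print: `G̃ − G₀ = Σ_{n≥1} G₀(Δ′_πG₀)ⁿ = O(α₀)`, p. 422 l. 1–6).  Proof = `transfer_pair_step`'s five
`M`∕`M†`-carrying terms without the leading `G₀f` ∕ `D*G₀f`. [folklore] [cite: Balaban1985BackgroundPropagators, (3.130)–(3.131) pp.421–422, (3.117) p.419,
(3.152) p.426] [cite: Balaban1984PropagatorsII, Lemma 2.1 (2.61) p.234] -/
theorem transfer_pair_diff (hδ0 : ∀ u v, 0 ≤ δ u v) (hδt : ∀ u y v, δ u v ≤ δ u y + δ y v)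
    (hT : ∀ f, Gt f = G₀ f + G₀ (M (Gp (R (Ds (Gt f))))) + G₀ (D (R (Gp (Mt (Gt f - D (Gp (R (Ds (Gt f))))))))))
    (h2 : ∀ s, G₀ (D (R s)) = D (Gp (R s)) - G₀ (M (Gp (R s))))
    (h3 : ∀ s, Ds (D (Gp (R s))) = R s)
    {B₀ B₁ BG BR BD ε₁ ε₂ κ κ' K M' : ℝ} (hB₀ : 0 ≤ B₀) (hB₁ : 0 ≤ B₁) (hBG : 0 ≤ BG) (hBR : 0 ≤ BR) (hBD : 0 ≤ BD)
    (hε₁ : 0 ≤ ε₁) (hε₂ : 0 ≤ ε₂) (hκ' : 0 ≤ κ') (hM' : 0 ≤ M')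
    (hG0 : ∀ (v : Y) (f : WL2 𝕜 wB VB) (F : ℝ), (∀ x, πB x ≠ v → WL2.equiv 𝕜 wB VB f x = 0) → (∀ x, ‖WL2.equiv 𝕜 wB VB f x‖ ≤ F) →
      ∀ x, ‖WL2.equiv 𝕜 wB VB (G₀ f) x‖ ≤ B₀ * Real.exp (-(κ * δ (πB x) v)) * F)
    (hDsG0 : ∀ (v : Y) (f : WL2 𝕜 wB VB) (F : ℝ), (∀ x, πB x ≠ v → WL2.equiv 𝕜 wB VB f x = 0) → (∀ x, ‖WL2.equiv 𝕜 wB VB f x‖ ≤ F) →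
      ∀ x, ‖WL2.equiv 𝕜 wS VS (Ds (G₀ f)) x‖ ≤ B₁ * Real.exp (-(κ * δ (πS x) v)) * F)
    (hGp : ∀ (v : Y) (s : WL2 𝕜 wS VS) (F : ℝ), (∀ x, πS x ≠ v → WL2.equiv 𝕜 wS VS s x = 0) → (∀ x, ‖WL2.equiv 𝕜 wS VS s x‖ ≤ F) →
      ∀ x, ‖WL2.equiv 𝕜 wS VS (Gp s) x‖ ≤ BG * Real.exp (-(κ * δ (πS x) v)) * F)
    (hR : ∀ (v : Y) (s : WL2 𝕜 wS VS) (F : ℝ), (∀ x, πS x ≠ v → WL2.equiv 𝕜 wS VS s x = 0) → (∀ x, ‖WL2.equiv 𝕜 wS VS s x‖ ≤ F) →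
      ∀ x, ‖WL2.equiv 𝕜 wS VS (R s) x‖ ≤ BR * Real.exp (-(κ * δ (πS x) v)) * F)
    (hDGR : ∀ (v : Y) (s : WL2 𝕜 wS VS) (F : ℝ), (∀ x, πS x ≠ v → WL2.equiv 𝕜 wS VS s x = 0) → (∀ x, ‖WL2.equiv 𝕜 wS VS s x‖ ≤ F) →
      ∀ x, ‖WL2.equiv 𝕜 wB VB (D (Gp (R s))) x‖ ≤ BD * Real.exp (-(κ * δ (πB x) v)) * F)
    (hM : ∀ (v : Y) (s : WL2 𝕜 wS VS) (F : ℝ), (∀ x, πS x ≠ v → WL2.equiv 𝕜 wS VS s x = 0) → (∀ x, ‖WL2.equiv 𝕜 wS VS s x‖ ≤ F) →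
      ∀ x, ‖WL2.equiv 𝕜 wB VB (M s) x‖ ≤ ε₁ * Real.exp (-(κ * δ (πB x) v)) * F)
    (hMt : ∀ (v : Y) (f : WL2 𝕜 wB VB) (F : ℝ), (∀ x, πB x ≠ v → WL2.equiv 𝕜 wB VB f x = 0) → (∀ x, ‖WL2.equiv 𝕜 wB VB f x‖ ≤ F) →
      ∀ x, ‖WL2.equiv 𝕜 wS VS (Mt f) x‖ ≤ ε₂ * Real.exp (-(κ * δ (πS x) v)) * F)
    (hS : ∀ w', ∑ u, Real.exp (-((κ - κ') * δ w' u)) ≤ K)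
    (hT1 : ∀ (v : Y) (f : WL2 𝕜 wB VB) (F : ℝ), (∀ x, πB x ≠ v → WL2.equiv 𝕜 wB VB f x = 0) → (∀ x, ‖WL2.equiv 𝕜 wB VB f x‖ ≤ F) →
      ∀ x, ‖WL2.equiv 𝕜 wB VB (Gt f) x‖ ≤ M' * Real.exp (-(κ' * δ (πB x) v)) * F)
    (hT2 : ∀ (v : Y) (f : WL2 𝕜 wB VB) (F : ℝ), (∀ x, πB x ≠ v → WL2.equiv 𝕜 wB VB f x = 0) → (∀ x, ‖WL2.equiv 𝕜 wB VB f x‖ ≤ F) →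
      ∀ x, ‖WL2.equiv 𝕜 wS VS (Ds (Gt f)) x‖ ≤ M' * Real.exp (-(κ' * δ (πS x) v)) * F) :
    (∀ (v : Y) (f : WL2 𝕜 wB VB) (F : ℝ), (∀ x, πB x ≠ v → WL2.equiv 𝕜 wB VB f x = 0) → (∀ x, ‖WL2.equiv 𝕜 wB VB f x‖ ≤ F) →
      ∀ x, ‖WL2.equiv 𝕜 wB VB ((Gt - G₀) f) x‖ ≤
        ((BR * K * BG * K * ε₁ * K * B₀ * K + ε₂ * K * BG * K * BD * K + BD * K * ε₂ * K * BG * K * BD * K +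
          ε₂ * K * BG * K * BR * K * BG * K * ε₁ * K * B₀ * K + BD * K * ε₂ * K * BG * K * BR * K * BG * K * ε₁ * K * B₀ * K) * M') *
        Real.exp (-(κ' * δ (πB x) v)) * F) ∧
    (∀ (v : Y) (f : WL2 𝕜 wB VB) (F : ℝ), (∀ x, πB x ≠ v → WL2.equiv 𝕜 wB VB f x = 0) → (∀ x, ‖WL2.equiv 𝕜 wB VB f x‖ ≤ F) →
      ∀ x, ‖WL2.equiv 𝕜 wS VS ((Ds ∘L Gt - Ds ∘L G₀) f) x‖ ≤
        ((BR * K * BG * K * ε₁ * K * B₁ * K + ε₂ * K * BG * K * BR * K + BD * K * ε₂ * K * BG * K * BR * K +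
          ε₂ * K * BG * K * BR * K * BG * K * ε₁ * K * B₁ * K + BD * K * ε₂ * K * BG * K * BR * K * BG * K * ε₁ * K * B₁ * K) * M') *
        Real.exp (-(κ' * δ (πS x) v)) * F) := by
  have hK : 0 ≤ K := by
    obtain ⟨x₀⟩ := ‹Nonempty XB›
    exact (Finset.sum_nonneg fun u _ => Real.exp_nonneg _).trans (hS (πB x₀))
  -- the a-priori letters and the coefficient letters as letters of continuous linear COMPOSITES (all `rfl`)
  have hT2' : ∀ (v : Y) (f : WL2 𝕜 wB VB) (F : ℝ), (∀ x, πB x ≠ v → WL2.equiv 𝕜 wB VB f x = 0) → (∀ x, ‖WL2.equiv 𝕜 wB VB f x‖ ≤ F) →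
      ∀ x, ‖WL2.equiv 𝕜 wS VS ((Ds ∘L Gt) f) x‖ ≤ M' * Real.exp (-(κ' * δ (πS x) v)) * F := hT2
  have hDsG0' : ∀ (v : Y) (f : WL2 𝕜 wB VB) (F : ℝ), (∀ x, πB x ≠ v → WL2.equiv 𝕜 wB VB f x = 0) → (∀ x, ‖WL2.equiv 𝕜 wB VB f x‖ ≤ F) →
      ∀ x, ‖WL2.equiv 𝕜 wS VS ((Ds ∘L G₀) f) x‖ ≤ B₁ * Real.exp (-(κ * δ (πS x) v)) * F := hDsG0
  have hDGR' : ∀ (v : Y) (s : WL2 𝕜 wS VS) (F : ℝ), (∀ x, πS x ≠ v → WL2.equiv 𝕜 wS VS s x = 0) → (∀ x, ‖WL2.equiv 𝕜 wS VS s x‖ ≤ F) →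
      ∀ x, ‖WL2.equiv 𝕜 wB VB ((D ∘L Gp ∘L R) s) x‖ ≤ BD * Real.exp (-(κ * δ (πB x) v)) * F := hDGR
  -- CHAIN c (from the divergence row `T₂ = D*∘G̃`): `R`, `G′`, `M`, then `G₀` resp. `D*G₀`
  have c1 := letter_comp δ πB πS πS (Ds ∘L Gt) R hδ0 hδt hM' hBR hκ' le_rfl hT2' hR hS
  have c2 := letter_comp δ πB πS πS (R ∘L (Ds ∘L Gt)) Gp hδ0 hδt (by positivity) hBG hκ' le_rfl c1 hGp hS
  have c3 := letter_comp δ πB πS πB (Gp ∘L (R ∘L (Ds ∘L Gt))) M hδ0 hδt (by positivity) hε₁ hκ' le_rfl c2 hM hS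
  have t1 := letter_comp δ πB πB πB (M ∘L (Gp ∘L (R ∘L (Ds ∘L Gt)))) G₀ hδ0 hδt (by positivity) hB₀ hκ' le_rfl c3 hG0 hS
  have u1 := letter_comp δ πB πB πS (M ∘L (Gp ∘L (R ∘L (Ds ∘L Gt)))) (Ds ∘L G₀) hδ0 hδt (by positivity) hB₁ hκ' le_rfl c3 hDsG0' hS
  -- CHAIN d (from the value row `T₁ = G̃`): `M†`, `G′`, then `D∘G′∘R` ∕ `R`, `G′`, `M`, `G₀` ∕ `D*G₀`
  have d1 := letter_comp δ πB πB πS Gt Mt hδ0 hδt hM' hε₂ hκ' le_rfl hT1 hMt hS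
  have d2 := letter_comp δ πB πS πS (Mt ∘L Gt) Gp hδ0 hδt (by positivity) hBG hκ' le_rfl d1 hGp hS
  have t2a := letter_comp δ πB πS πB (Gp ∘L (Mt ∘L Gt)) (D ∘L Gp ∘L R) hδ0 hδt (by positivity) hBD hκ' le_rfl d2 hDGR' hS
  have u2a := letter_comp δ πB πS πS (Gp ∘L (Mt ∘L Gt)) R hδ0 hδt (by positivity) hBR hκ' le_rfl d2 hR hS
  have d5 := letter_comp δ πB πS πS (R ∘L (Gp ∘L (Mt ∘L Gt))) Gp hδ0 hδt (by positivity) hBG hκ' le_rfl u2a hGp hS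
  have d6 := letter_comp δ πB πS πB (Gp ∘L (R ∘L (Gp ∘L (Mt ∘L Gt)))) M hδ0 hδt (by positivity) hε₁ hκ' le_rfl d5 hM hS
  have t3a := letter_comp δ πB πB πB (M ∘L (Gp ∘L (R ∘L (Gp ∘L (Mt ∘L Gt))))) G₀ hδ0 hδt (by positivity) hB₀ hκ' le_rfl d6 hG0 hS
  have u3a := letter_comp δ πB πB πS (M ∘L (Gp ∘L (R ∘L (Gp ∘L (Mt ∘L Gt))))) (Ds ∘L G₀) hδ0 hδt (by positivity) hB₁ hκ' le_rfl d6 hDsG0' hS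
  -- CHAIN e (from `T₂` through `D∘G′∘R`): `M†`, `G′`, then `D∘G′∘R` ∕ `R`, `G′`, `M`, `G₀` ∕ `D*G₀`
  have e1 := letter_comp δ πB πS πB (Ds ∘L Gt) (D ∘L Gp ∘L R) hδ0 hδt hM' hBD hκ' le_rfl hT2' hDGR' hS
  have e2 := letter_comp δ πB πB πS ((D ∘L Gp ∘L R) ∘L (Ds ∘L Gt)) Mt hδ0 hδt (by positivity) hε₂ hκ' le_rfl e1 hMt hS
  have e3 := letter_comp δ πB πS πS (Mt ∘L ((D ∘L Gp ∘L R) ∘L (Ds ∘L Gt))) Gp hδ0 hδt (by positivity) hBG hκ' le_rfl e2 hGp hS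
  have t2b := letter_comp δ πB πS πB (Gp ∘L (Mt ∘L ((D ∘L Gp ∘L R) ∘L (Ds ∘L Gt)))) (D ∘L Gp ∘L R) hδ0 hδt (by positivity) hBD hκ' le_rfl e3 hDGR' hS
  have u2b := letter_comp δ πB πS πS (Gp ∘L (Mt ∘L ((D ∘L Gp ∘L R) ∘L (Ds ∘L Gt)))) R hδ0 hδt (by positivity) hBR hκ' le_rfl e3 hR hS
  have e6 := letter_comp δ πB πS πS (R ∘L (Gp ∘L (Mt ∘L ((D ∘L Gp ∘L R) ∘L (Ds ∘L Gt))))) Gp hδ0 hδt (by positivity) hBG hκ' le_rfl u2b hGp hS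
  have e7 := letter_comp δ πB πS πB (Gp ∘L (R ∘L (Gp ∘L (Mt ∘L ((D ∘L Gp ∘L R) ∘L (Ds ∘L Gt)))))) M hδ0 hδt (by positivity) hε₁ hκ' le_rfl e6 hM hS
  have t3b := letter_comp δ πB πB πB (M ∘L (Gp ∘L (R ∘L (Gp ∘L (Mt ∘L ((D ∘L Gp ∘L R) ∘L (Ds ∘L Gt))))))) G₀ hδ0 hδt (by positivity) hB₀ hκ' le_rfl
    e7 hG0 hS
  have u3b := letter_comp δ πB πB πS (M ∘L (Gp ∘L (R ∘L (Gp ∘L (Mt ∘L ((D ∘L Gp ∘L R) ∘L (Ds ∘L Gt))))))) (Ds ∘L G₀) hδ0 hδt (by positivity) hB₁ hκ'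
    le_rfl e7 hDsG0' hS
  -- the expanded identities
  have hs : ∀ f, Gp (Mt (Gt f - D (Gp (R (Ds (Gt f)))))) = Gp (Mt (Gt f)) - Gp (Mt (D (Gp (R (Ds (Gt f)))))) := fun f => by
    rw [map_sub, map_sub]
  have hval : ∀ f, Gt f = G₀ f + G₀ (M (Gp (R (Ds (Gt f))))) +
      (D (Gp (R (Gp (Mt (Gt f))))) - D (Gp (R (Gp (Mt (D (Gp (R (Ds (Gt f)))))))))) -
      (G₀ (M (Gp (R (Gp (Mt (Gt f)))))) - G₀ (M (Gp (R (Gp (Mt (D (Gp (R (Ds (Gt f))))))))))) := fun f => by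
    have h := hT f
    rw [h2, hs] at h
    refine h.trans ?_
    simp only [map_sub]; abel
  have hdiv : ∀ f, Ds (Gt f) = Ds (G₀ f) + Ds (G₀ (M (Gp (R (Ds (Gt f)))))) +
      (R (Gp (Mt (Gt f))) - R (Gp (Mt (D (Gp (R (Ds (Gt f)))))))) -
      (Ds (G₀ (M (Gp (R (Gp (Mt (Gt f))))))) - Ds (G₀ (M (Gp (R (Gp (Mt (D (Gp (R (Ds (Gt f)))))))))))) := fun f => by
    have h := hT f
    rw [h2, hs] at h
    refine (congrArg Ds h).trans ?_
    simp only [map_sub, map_add, h3]; abel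
  have hval' : ∀ f, Gt f - G₀ f = G₀ (M (Gp (R (Ds (Gt f))))) +
      (D (Gp (R (Gp (Mt (Gt f))))) - D (Gp (R (Gp (Mt (D (Gp (R (Ds (Gt f)))))))))) -
      (G₀ (M (Gp (R (Gp (Mt (Gt f)))))) - G₀ (M (Gp (R (Gp (Mt (D (Gp (R (Ds (Gt f))))))))))) := fun f => by
    calc Gt f - G₀ f = (G₀ f + G₀ (M (Gp (R (Ds (Gt f))))) +
      (D (Gp (R (Gp (Mt (Gt f))))) - D (Gp (R (Gp (Mt (D (Gp (R (Ds (Gt f)))))))))) -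
      (G₀ (M (Gp (R (Gp (Mt (Gt f)))))) - G₀ (M (Gp (R (Gp (Mt (D (Gp (R (Ds (Gt f)))))))))))) - G₀ f :=
          congrArg (fun z => z - G₀ f) (hval f)
      _ = _ := by abel
  have hdiv' : ∀ f, Ds (Gt f) - Ds (G₀ f) = Ds (G₀ (M (Gp (R (Ds (Gt f)))))) +
      (R (Gp (Mt (Gt f))) - R (Gp (Mt (D (Gp (R (Ds (Gt f)))))))) -
      (Ds (G₀ (M (Gp (R (Gp (Mt (Gt f))))))) - Ds (G₀ (M (Gp (R (Gp (Mt (D (Gp (R (Ds (Gt f)))))))))))) := fun f => by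
    calc Ds (Gt f) - Ds (G₀ f) = (Ds (G₀ f) + Ds (G₀ (M (Gp (R (Ds (Gt f)))))) +
      (R (Gp (Mt (Gt f))) - R (Gp (Mt (D (Gp (R (Ds (Gt f)))))))) -
      (Ds (G₀ (M (Gp (R (Gp (Mt (Gt f))))))) - Ds (G₀ (M (Gp (R (Gp (Mt (D (Gp (R (Ds (Gt f))))))))))))) - Ds (G₀ f) :=
          congrArg (fun z => z - Ds (G₀ f)) (hdiv f)
      _ = _ := by abel
  refine ⟨fun v f F hfv hfF x => ?_, fun v f F hfv hfF x => ?_⟩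
  · -- THE VALUE ROW OF THE DIFFERENCE
    set E : ℝ := Real.exp (-(κ' * δ (πB x) v))
    have a1 : ‖WL2.equiv 𝕜 wB VB (G₀ (M (Gp (R (Ds (Gt f)))))) x‖ ≤ M' * BR * K * BG * K * ε₁ * K * B₀ * K * E * F := t1 v f F hfv hfF x
    have a2 : ‖WL2.equiv 𝕜 wB VB (D (Gp (R (Gp (Mt (Gt f)))))) x‖ ≤ M' * ε₂ * K * BG * K * BD * K * E * F := t2a v f F hfv hfF x
    have a3 : ‖WL2.equiv 𝕜 wB VB (D (Gp (R (Gp (Mt (D (Gp (R (Ds (Gt f)))))))))) x‖ ≤ M' * BD * K * ε₂ * K * BG * K * BD * K * E * F :=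
      t2b v f F hfv hfF x
    have a4 : ‖WL2.equiv 𝕜 wB VB (G₀ (M (Gp (R (Gp (Mt (Gt f))))))) x‖ ≤ M' * ε₂ * K * BG * K * BR * K * BG * K * ε₁ * K * B₀ * K * E * F :=
      t3a v f F hfv hfF x
    have a5 : ‖WL2.equiv 𝕜 wB VB (G₀ (M (Gp (R (Gp (Mt (D (Gp (R (Ds (Gt f))))))))))) x‖ ≤
        M' * BD * K * ε₂ * K * BG * K * BR * K * BG * K * ε₁ * K * B₀ * K * E * F := t3b v f F hfv hfF x
    change ‖WL2.equiv 𝕜 wB VB (Gt f - G₀ f) x‖ ≤ _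
    rw [hval' f]
    simp only [WL2.equiv_add, WL2.equiv_sub, Pi.add_apply, Pi.sub_apply]
    refine (norm_five_le _ _ _ _ _).trans ?_
    have hsum := add_le_add (add_le_add (add_le_add (add_le_add a1 a2) a3) a4) a5
    refine hsum.trans (le_of_eq ?_)
    ring
  · -- THE DIVERGENCE ROW OF THE DIFFERENCE
    set E : ℝ := Real.exp (-(κ' * δ (πS x) v))
    have a1 : ‖WL2.equiv 𝕜 wS VS (Ds (G₀ (M (Gp (R (Ds (Gt f))))))) x‖ ≤ M' * BR * K * BG * K * ε₁ * K * B₁ * K * E * F := u1 v f F hfv hfF x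
    have a2 : ‖WL2.equiv 𝕜 wS VS (R (Gp (Mt (Gt f)))) x‖ ≤ M' * ε₂ * K * BG * K * BR * K * E * F := u2a v f F hfv hfF x
    have a3 : ‖WL2.equiv 𝕜 wS VS (R (Gp (Mt (D (Gp (R (Ds (Gt f)))))))) x‖ ≤ M' * BD * K * ε₂ * K * BG * K * BR * K * E * F := u2b v f F hfv hfF x
    have a4 : ‖WL2.equiv 𝕜 wS VS (Ds (G₀ (M (Gp (R (Gp (Mt (Gt f)))))))) x‖ ≤ M' * ε₂ * K * BG * K * BR * K * BG * K * ε₁ * K * B₁ * K * E * F :=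
      u3a v f F hfv hfF x
    have a5 : ‖WL2.equiv 𝕜 wS VS (Ds (G₀ (M (Gp (R (Gp (Mt (D (Gp (R (Ds (Gt f)))))))))))) x‖ ≤
        M' * BD * K * ε₂ * K * BG * K * BR * K * BG * K * ε₁ * K * B₁ * K * E * F := u3b v f F hfv hfF x
    change ‖WL2.equiv 𝕜 wS VS (Ds (Gt f) - Ds (G₀ f)) x‖ ≤ _
    rw [hdiv' f]
    simp only [WL2.equiv_add, WL2.equiv_sub, Pi.add_apply, Pi.sub_apply]
    refine (norm_five_le _ _ _ _ _).trans ?_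
    have hsum := add_le_add (add_le_add (add_le_add (add_le_add a1 a2) a3) a4) a5
    refine hsum.trans (le_of_eq ?_)
    ring

end Abstract

end Literature.MathematicalPhysics.QuantumFieldTheory.Balaban1983to89.B9Eq3130TransferPairDifference

end
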